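import Mathlib.Analysis.Convex.Hull
import Mathlib.Analysis.SpecialFunctions.Pow.Real
import Literature.Barriers.PneNP.TSPExtensionComplexity
import Literature.Combinatorics.SimpleGraph.SubcubicMinors
import Literature.Computability.MetaComplexity.GridTseitinLift
import HarnessLib

/-!
# Correlation polytopes of graphs with a large grid minor have exponential extension complexity
# (Aboulker–Fiorini–Huynh–Macchia–Seif 2019)

[topic Combinatorics/Optimization]

TYPED STATEMENT (one named fact, not proved here) from P. Aboulker, S. Fiorini, T. Huynh,
M. Macchia, J. Seif, *Extension complexity of the correlation polytope*, Oper. Res. Lett. 47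
(2019) 47–51 = arXiv:1806.00541 [AboulkerEtAl2019] (held text `paper:arxiv-1806.00541`; `pNNNN Lk`
= chunk/line of the lit-read materialisation), in the tree's extension-complexity currency
(`Literature.Barriers.PneNP.HasEFOfSize P R`: "`P` is the projection of a slack-form system with `R`
sign-constrained variables"; "`xc(P) ≥ B`" reads `∀ R, HasEFOfSize P R → B ≤ R`, as in
`TSPExtensionComplexity`).

**Printed definitions.** §1 (p0003 L3): "All graphs in this paper are undirected and simple. Let
`G = (V, E)` be a graph. The correlation polytope of `G`, denoted `COR(G)`, is the convex hull of
the characteristic vectors of induced subgraphs of `G`. More precisely, `COR(G)` is the polytope in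
`ℝ^{V ∪ E}` which is the convex hull of all vectors of the form `(χ(X), χ(E(X)))` for `X ⊆ V`, where
`E(X)` is the set of edges with both endpoints in `X`" (equivalently, proof of Thm. 1, p0003 L33:
"the convex hull of all `0/1`-vectors `x ∈ ℝ^{V ∪ E}` satisfying `x_{uv} = x_u x_v` for all
`uv ∈ E(G)`"). §1 (p0003 L14): "A graph `H` is a minor of a graph `G`, denoted `H ≼ G`, if `H` can be
obtained from a subgraph of `G` by contracting edges" — the tree's `IsMinor` (`SubcubicMinors.lean`).
§2 (p0005 L21): "`G_{h,h}` [is] the `h × h` grid. Recall that `G_{h,h}` has vertex set `[h] × [h]`,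
where `(a,b)` is adjacent to `(a',b')` if and only if `|a−a'| + |b−b'| = 1`" — the tree's
`Literature.Computability.MetaComplexity.gridGraph h` on `Fin (h·h)` (row `a / h`, column `a % h`;
`GridTseitinLift.lean`).

**Rendering of `COR(G)`.** `corPolytopeGraph G ⊆ ℝ^{V × V}` is the zero-padded symmetric copy of the
printed `COR(G) ⊆ ℝ^{V ∪ E}`: the vertex coordinate `x_v` sits at `(v, v)`, the edge coordinate
`x_{uv}` at both `(u, v)` and `(v, u)`, and the coordinates `(u, v)` with `u ≠ v`, `uv ∉ E` are
identically `0` (the masking device of `Literature.Combinatorics.Optimization.corPolytope`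
(`BlockPsdLiftFactorization.lean`), which is the `G = K_n` case `COR(n) = conv{a aᵀ}` flattened to
`ℝ^{n·n}`; not restated here). The two copies are coordinate projections / duplications-with-zero-
padding of each other, which do not change extension complexity (`TSPExtensionComplexityFaces.lean`:
appending the equations `x_{(u,v)} = x_{(v,u)}`, `x_{(u,v)} = 0` is free, `HasEFOfSize.inter_eqs`).

**Printed results.** Observation 4 (p0005 L5–8): "For all `n`-vertex graphs `G`, `xc(COR(G)) ≥ n`."
Observation 5 (p0005 L12–13): "If `H ≼ G`, then `xc(COR(H)) ≤ xc(COR(G))`." Theorem 6 (p0005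
L41–46): "For every proper minor-closed class `𝒞`, there exists a constant `c' > 0` such that for
every `n`-vertex graph `G ∈ 𝒞`, `xc(COR(G)) ≥ 2^{c' tw(G)}`." and the remark after Theorem 3 (p0004
L1): "Actually, the proof of Theorem 6 shows that for every graph `G`, we have
`xc(COR(G)) ≥ 2^{Ω(h + log n)}`, where `h` is the maximum height of a grid that `G` contains as a
minor." (Proof of Thm. 6, p0005 L49 – p0006 L22: a grid with gadgets `H` of height `h = Ω(t)` is a
minor of `G_{t,t}`; a face of `COR(H)` projects to `COR(K_{h,h})`; `K_h ≼ K_{h,h}`; "In [KW15], it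
is shown that `xc(COR(K_h)) ≥ (1.5)^h`" — Kaibel–Weltge, a theorem of the tree,
`Literature/Barriers/PneNP/KaibelWeltge*.lean`.)

**Typed here** (`AboulkerEtAl2019_corGridMinor`): the GRID-MINOR form of the remark with the
`log n` term DROPPED (a weakening of print): there is an absolute `c > 0` such that every finite
simple graph `G` containing the `h × h` grid as a minor, `h ≥ 1`, has `xc(COR(G)) ≥ 2^{c·h}`, i.e.
`2^{c h} ≤ R` for every size `R` of an extended formulation of `corPolytopeGraph G`. The `Ω` is
unfolded with a THRESHOLD (`∃ c > 0, ∃ h₀, ∀ h ≥ h₀`), the reading that is never stronger than print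
(the consolidation to all `h ≥ 1` with one constant is true — `xc(COR(G)) ≥ n ≥ h²` by Obs. 4 — but
is not asserted here). General in `G` (not pre-instantiated at `G = G_{t,t}`); the grid instance is
the proved corollary `AboulkerEtAl2019_corGridMinor.grid` (reflexivity of `IsMinor`). Coordinates:
print's `ℝ^{V ∪ E}` ↪ `ℝ^{V × V}` by `v ↦ (v,v)`, `uv ↦ (u,v)` and `(v,u)` (index dictionary for the
consumer's face/projection glue; unfolding lemmas `corVec_apply_diag` / `corVec_apply_adj` /
`corVec_apply_of_not_adj`).

## References

* [AboulkerEtAl2019] P. Aboulker, S. Fiorini, T. Huynh, M. Macchia, J. Seif, *Extension complexity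
  of the correlation polytope*, Oper. Res. Lett. 47 (2019) 47–51, doi:10.1016/j.orl.2018.12.001 =
  arXiv:1806.00541; §1 (COR(G), minors), Obs. 4, Obs. 5, Thm. 6 and the remark after Thm. 3. Read:
  held text, chunks p0003–p0006.
* [KaibelWeltge2014] V. Kaibel, S. Weltge, *A short proof that the extension complexity of the
  correlation polytope grows exponentially*, DCG 53 (2015) — the seed bound `xc(COR(K_h)) ≥ 1.5^h`
  (tree: `Literature.Barriers.PneNP.KaibelWeltge`).
* [HastadRisse2025] for the tree's `gridGraph` (`GridTseitinLift.lean`).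
-/

noncomputable section

namespace Literature.Combinatorics.Optimization

open Literature.Barriers.PneNP (HasEFOfSize)
open Literature.Combinatorics.SimpleGraph (IsMinor)
open Literature.Computability.MetaComplexity (gridGraph)

variable {V : Type} [DecidableEq V]

/-! ### The correlation polytope of a graph (§1) -/

/-- The vertex `(χ(X), χ(E(X)))` of `COR(G)` attached to `X ⊆ V` (`b` = indicator of `X`), written in
`ℝ^{V × V}`: `x_{(v,v)} = 𝟙[v ∈ X]`, `x_{(u,v)} = x_{(v,u)} = 𝟙[u ∈ X ∧ v ∈ X]` for `uv ∈ E`, and `0`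
at non-adjacent off-diagonal pairs (index dictionary `ℝ^{V ∪ E} ↪ ℝ^{V × V}`: `v ↦ (v,v)`, `uv ↦ (u,v), (v,u)`).
[cite: AboulkerEtAl2019, §1 (p0003 L3) and proof of Thm. 1 (p0003 L33)] -/
def corVec (G : SimpleGraph V) [DecidableRel G.Adj] (b : V → Bool) : V × V → ℝ :=
  fun p => if p.1 = p.2 then (if b p.1 then 1 else 0)
    else if G.Adj p.1 p.2 then (if b p.1 && b p.2 then 1 else 0) else 0

/-- Diagonal (vertex) coordinates of `corVec`. [cite: AboulkerEtAl2019, §1 (p0003 L3)] -/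
theorem corVec_apply_diag (G : SimpleGraph V) [DecidableRel G.Adj] (b : V → Bool) (v : V) :
    corVec G b (v, v) = if b v then 1 else 0 := by
  simp [corVec]

/-- Edge coordinates of `corVec`. [cite: AboulkerEtAl2019, §1 (p0003 L3)] -/
theorem corVec_apply_adj (G : SimpleGraph V) [DecidableRel G.Adj] (b : V → Bool) {u v : V}
    (h : G.Adj u v) : corVec G b (u, v) = if (b u && b v) then 1 else 0 := by
  simp [corVec, h, h.ne]

/-- Masked coordinates of `corVec` vanish. [cite: AboulkerEtAl2019, §1 (p0003 L3)] -/
theorem corVec_apply_of_not_adj (G : SimpleGraph V) [DecidableRel G.Adj] (b : V → Bool) {u v : V}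
    (huv : u ≠ v) (h : ¬ G.Adj u v) : corVec G b (u, v) = 0 := by
  simp [corVec, huv, h]

/-- `corVec` is symmetric in the two coordinates. [cite: AboulkerEtAl2019, §1 (p0003 L3)] -/
theorem corVec_swap (G : SimpleGraph V) [DecidableRel G.Adj] (b : V → Bool) (u v : V) :
    corVec G b (u, v) = corVec G b (v, u) := by
  by_cases huv : u = v
  · subst huv; rfl
  · by_cases h : G.Adj u v
    · rw [corVec_apply_adj G b h, corVec_apply_adj G b h.symm, Bool.and_comm]
    · rw [corVec_apply_of_not_adj G b huv h,
        corVec_apply_of_not_adj G b (Ne.symm huv) (fun h' => h h'.symm)]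

/-- Entries of `corVec` are `0` or `1`. [cite: AboulkerEtAl2019, proof of Thm. 1 (p0003 L33: "0/1-vectors")] -/
theorem corVec_zero_or_one (G : SimpleGraph V) [DecidableRel G.Adj] (b : V → Bool) (p : V × V) :
    corVec G b p = 0 ∨ corVec G b p = 1 := by
  unfold corVec; split_ifs <;> simp

/-- **The correlation polytope `COR(G)`** of a graph (zero-padded symmetric copy in `ℝ^{V × V}`):
the convex hull of the vectors `corVec G b`, `b ∈ {0,1}^V`.
[cite: AboulkerEtAl2019, §1 (p0003 L3)] -/
def corPolytopeGraph (G : SimpleGraph V) [DecidableRel G.Adj] : Set (V × V → ℝ) :=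
  convexHull ℝ (Set.range (corVec G))

/-- The generating vectors lie in `COR(G)`. [cite: AboulkerEtAl2019, §1 (p0003 L3)] -/
theorem corVec_mem_corPolytopeGraph (G : SimpleGraph V) [DecidableRel G.Adj] (b : V → Bool) :
    corVec G b ∈ corPolytopeGraph G :=
  subset_convexHull ℝ _ ⟨b, rfl⟩

/-- `COR(G)` is convex. [cite: AboulkerEtAl2019, §1 (p0003 L3)] -/
theorem convex_corPolytopeGraph (G : SimpleGraph V) [DecidableRel G.Adj] :
    Convex ℝ (corPolytopeGraph G) :=
  convex_convexHull ℝ _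

/-! ### The named fact -/

/-- **Aboulker–Fiorini–Huynh–Macchia–Seif 2019 (grids as minors force exponential `xc(COR)`;
Thm. 6 via its proof / the remark after Thm. 3, `log n` term dropped).** Printed: "the proof of
Theorem 6 shows that for every graph `G`, we have `xc(COR(G)) ≥ 2^{Ω(h + log n)}`, where `h` is the
maximum height of a grid that `G` contains as a minor" (with Thm. 6: "for every proper minor-closed
class `𝒞`, there exists a constant `c' > 0` such that for every `n`-vertex graph `G ∈ 𝒞`,
`xc(COR(G)) ≥ 2^{c' tw(G)}`", and Obs. 5: `xc(COR(·))` is minor-monotone). Typed (weaker than print: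
no `log n`; `Ω` unfolded with a threshold, the never-stronger reading): there are `c > 0` and `h₀`
such that for every `h ≥ h₀` and every finite simple graph `G` with `G_{h,h} ≼ G` (the tree's
`gridGraph h` on `Fin (h·h)` — its `gridAdj` is "same row and columns differ by `1`, or same column
and rows differ by `1`" in the row-major decoding `(a / h, a % h)`, i.e. the printed
`|a−a'| + |b−b'| = 1` — and the tree's `IsMinor`), every extended formulation of `COR(G)`
(`corPolytopeGraph G`) has size `R ≥ 2^{c·h}`. NOT proved here (route of proof: grid with gadgets
`≼ G_{t,t}`, a face of its `COR` projects onto `COR(K_{h,h}) ⊇` a copy of `COR(K_h)`, and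
Kaibel–Weltge `xc(COR(K_h)) ≥ 1.5^h`).
[cite: AboulkerEtAl2019, remark after Thm. 3 (arXiv p. 4, lit-read p0004 L1: "the proof of Theorem 6 shows …") with Thm. 6 (§2, p0005 L41–46) and Obs. 5 (p0005 L12–13)] -/
def AboulkerEtAl2019_corGridMinor : Prop :=
  ∃ c : ℝ, 0 < c ∧ ∃ h₀ : ℕ, ∀ h : ℕ, h₀ ≤ h →
    ∀ (V : Type) [Fintype V] [DecidableEq V] (G : SimpleGraph V) [DecidableRel G.Adj],
      IsMinor (gridGraph h) G →
        ∀ R : ℕ, HasEFOfSize (corPolytopeGraph G) R → (2 : ℝ) ^ (c * h) ≤ R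

/-- **The grid instance** (the form consumed by the `ValiantsHypothesis` queue-grid line): since
`G_{t,t} ≼ G_{t,t}`, `xc(COR(G_{t,t})) ≥ 2^{c t}` for all `t ≥ t₀`. PROVED from the fact by
reflexivity of `IsMinor`. [cite: AboulkerEtAl2019, Thm. 6 with 𝒞 = planar graphs, G = G_{t,t} (p0005 L41–49)] -/
theorem AboulkerEtAl2019_corGridMinor.grid (hyp : AboulkerEtAl2019_corGridMinor) :
    ∃ c : ℝ, 0 < c ∧ ∃ t₀ : ℕ, ∀ t : ℕ, t₀ ≤ t →
      ∀ R : ℕ, HasEFOfSize (corPolytopeGraph (gridGraph t)) R → (2 : ℝ) ^ (c * t) ≤ R := by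
  obtain ⟨c, hc, h₀, H⟩ := hyp
  exact ⟨c, hc, h₀, fun t ht R hR => H t ht (Fin (t * t)) (gridGraph t) (IsMinor.refl _) R hR⟩

end Literature.Combinatorics.Optimization
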